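import Summits.QuantumFields.YangMills.Theorems.UnitScaleTiltHalvingHSupURhoWindowsRho3
import HarnessLib

/-!
# `hP1room` PROGRAMME (LEAD-H «(K-final)», row «w8-19936: (K-final-windows-bridge) — WIDENED»): ★ THE SCALAR WINDOWS OF THE k = 1 COMPOSER AND OF ITS TORUS
# SOCKET FROM THE ONE CUBIC SMALLNESS — the `obtain`ed tuple of ✓`HalvingHSupURhoWindowsRho3.exists_topCall_constants_of_rhoWindow₃` re-lettered into EXACTLY the
# displayed scalar hypotheses of ✓`HalvingHSiteRowsOfSocketsBase.siteRows_of_sockets_base` (p660425) and the window arguments of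
# ✓`HalvingHSiteTorusSocketBase.hTorus_base_of_windows` ∕ `torusPackage_of_reads` (p661059)

Route `UnitScaleTilt`, crux K1 child «MinimiserStabilityRegPr» (stmt-QuantumFields-19200), registered stub `stub_halvingStep` (`BirthV10`); cell `ym3-torus` (HUMAN RULING
D-0037: YM₃ on T³ is ladder rung R3 — NOT d = 4, NOT a mass gap, NOT the Clay problem), twin-width seat `ym-ust-19936-w8` gen 4.  `--supports stmt-QuantumFields-19200
--as helper`; THEOREMS ONLY (0 `def`, 0 `sorry`); count-neutral; nothing here claims `core′`, `hMember(L)`, `hSupU(ρ3)`, the stub, the crux or the gap.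

WHAT.  ★`baseArgs_of_hw` — for `d = 3`, `L ≥ 3`, a window `(M′ ≥ 1, ρ′)`, the socket constants `B₀ > 0`, `B₀'H > 0`, `B₂' BG BR ≥ 0`, `cB9 > 0`, a size letter `Bsz` with
`(2985·L·B₀ + 405)·(ρ′+M′+1) ≤ Bsz`, and ε₀ under the ONE cubic smallness `hw` of ✓`exists_topCall_constants_of_rhoWindow₃`: there are
`s c⋆ C₂ cB cA cDA Cb Cl α₁ α₄ σ δ ω τ₀ m₀` satisfying
(b) EVERY scalar window of ✓`siteRows_of_sockets_base` IN ITS BINDER ORDER — `hε hsdef hs6 hα₁ hα₄ hc hα3 hα4 h16 hd5 hsmallP hc₃P hside h50 hC₂ h61 hcBlo hsmall hc₃ hsc hα₃'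
hs₁ … hs₆ hprod8 hα70 hcA0 hcA12 hcA13 hcAw hcDAw hCb hCl hCbρ hClB h2s hs1 hbudget hcsB` (`s := a₆₆ = (198 + 12(M′ − 1 + 4ρ′))ε₀`, `c⋆ = 5dLB₀(ε₀ + α₁)`, `hbudget` at
`c′ := 2L(2s)`), and (a) the 13 window arguments of ✓`hTorus_base_of_windows` IN ITS ORDER — `hs0 hα₄ hsσ hδ hω hτ₀ hbudget hm hm₀ hr hCb₀ hCl₀ hwin` (`hsσ` at `k = 1`:
`s ≤ (L¹)⁻¹σ`).  So (K-final) does ONE `obtain` and two `exact`s per member.  The only non-`exact` steps (all [folklore] arithmetic): `hε` (every factor of `hw` is `≥ 1`);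
`hcDAw` (`4a₆₆ ≤ 405(ρ′+M′+1)ε₀ ≤ 5dLB₀α₁ ≤ c⋆`, using `M′ ≥ 1` and `α₁`'s `27s′∕(LB₀)` term); `hcsB` (`c⋆ = 15LB₀ε₀ + 2970LB₀s′ + 405s′ ≤ (2985LB₀ + 405)s′`);
`hbudget` (`2L(2s) ≤ 2L(c⋆ + a₆₆) = σ`); `hsσ` (`2La₆₆ ≤ σ`); `hm₀` (`3(M′+ρ′) ≤ 3(M′+ρ′)+1`).
HONEST SCOPE.  Real-arithmetic bookkeeping between two landed binder lists; nothing of [Balaban1985RegularSpaces] Prop. 5 ∕ Sect. E ∕ Theorem 4, `core′`, `hMember` or the stub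
is proved here.

References: T. Bałaban, CMP **99** (1985) 75–102 [Balaban1985RegularSpaces] (Thm 4 p.88, Prop. 3 p.87, Prop. 5 (1.106) p.94, Sect. E (1.110)–(1.125) pp.95–97);
CMP **98** (1985) 17–51 [Balaban1985Averaging] ((54) p.26, (203)–(214) pp.49–50); CMP **102** (1985) 277–309 [Balaban1985Variational] ((150)–(168) pp.301–304).
-/

set_option autoImplicit false

noncomputable section

namespace Summit.QuantumFields.YangMills.Theorems.HalvingHSiteBaseArgsOfRhoWindow

open Literature.MathematicalPhysics.QuantumFieldTheory.Balaban1983to89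
open B7Prop2Explicit (C0 c2')
open B7Prop3Flat (c3)
open B7Prop9Flat (C5')
open B7Prop10General (C6 C4G)
open B8Ineq125Concrete (C2p)
open B8Prop5ContractionKLevel (Mc Kc)
open Summit.QuantumFields.YangMills.Theorems.HalvingHSupURhoWindowsRho3 (exists_topCall_constants_of_rhoWindow₃)

set_option maxHeartbeats 400000 in
/-- ★ **THE SCALAR WINDOWS OF THE k = 1 COMPOSER AND OF ITS TORUS SOCKET FROM THE ONE CUBIC SMALLNESS** — see the module docstring: (b) = the scalar binders of
✓`siteRows_of_sockets_base` in order (at `s := a₆₆`), (a) = the window arguments of ✓`hTorus_base_of_windows` in order (at `k = 1`).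
[cite: Balaban1985RegularSpaces, Thm 4 p.88, Prop. 3 p.87, Prop. 5 (1.106) p.94, Sect. E (1.110)-(1.125) pp.95-97; Balaban1985Averaging, (54) p.26, (203)-(214) pp.49-50; Balaban1985Variational, (150)-(168) pp.301-304] -/
theorem baseArgs_of_hw (d L : ℕ) (hd : d = 3) (hL : 3 ≤ L)
    {B₀ B₀'H B₂' BG BR cB9 Bsz : ℝ} (hB₀ : 0 < B₀) (hB₀'H : 0 < B₀'H) (hB₂' : 0 ≤ B₂') (hBG : 0 ≤ BG) (hBR : 0 ≤ BR) (hcB9 : 0 < cB9)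
    (M' ρ' : ℕ) (hM' : 1 ≤ M') {ε₀ : ℝ} (hε₀ : 0 < ε₀)
    (hw : (10 : ℝ) ^ 29 * (L : ℝ) ^ 12 * (1 + B₀ + B₀⁻¹) ^ 2 * ((1 + B₀'H) * (1 + B₂') * (1 + BG) * (1 + BR)) ^ 5 * (1 + cB9⁻¹) *
      (((ρ' : ℝ) + M' + 1) ^ 3 * ε₀) ≤ 1)
    (hBsz : (2985 * (L : ℝ) * B₀ + 405) * ((ρ' : ℝ) + M' + 1) ≤ Bsz) :
    ∃ (s cstar C₂ cB cA cDA Cb Cl α₁ α₄ σ δ ω τ₀ : ℝ) (m₀ : ℕ),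
      -- (b) the scalar windows of ✓`siteRows_of_sockets_base`, in its binder order
      (10 ^ 7 * (L : ℝ) ^ 3 * ε₀ ≤ 1 ∧ s = (198 + 12 * (((M' : ℝ) - 1) + 4 * ρ')) * ε₀ ∧ s ≤ 1 / 6 ∧ 0 < α₁ ∧ 0 < α₄ ∧
        cstar = 5 * d * L * B₀ * (ε₀ + α₁) ∧
        C0 d * ε₀ ≤ 1 / 3 ∧ 4 * ε₀ ≤ c2' d L ∧
        16 * (2 * (L * cstar) + 8 * α₄) ≤ 1 ∧ 5 * (2 * (L * cstar) + 8 * α₄) * ((d : ℝ) - 1) ≤ 4 ∧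
        Real.exp (4 * (800 * ((d : ℝ) + 1) ^ 2 * ((d : ℝ) + 4)) * ε₀) * (1 + 8 * (131072 * ((d : ℝ) + 1) ^ 2) * (2 * (L * cstar) + 8 * α₄)) ≤ 2 ∧
        2 * (2 * (L * cstar) + 8 * α₄) ≤ c3 d L ∧ 36 * d * B₀ * (2 * (L * cstar) + 8 * α₄) ≤ 1 / 2 ∧
        50 * d * (2 * (L * cstar) + 8 * α₄) ≤ 1 ∧
        8 * (131072 * ((d : ℝ) + 1) ^ 2) * Real.exp (4 * (800 * ((d : ℝ) + 1) ^ 2 * ((d : ℝ) + 4)) * ε₀) ≤ C₂ ∧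
        2 * (2 * (L * cstar) + 8 * α₄) ^ 2 + 20 * d * ε₀ * (2 * (L * cstar) + 8 * α₄) + 2 * C₂ * (2 * (L * cstar) + 8 * α₄) ^ 2 ≤ ε₀ + α₁ ∧
        L * cstar ≤ cB ∧
        Real.exp (4 * (800 * ((d : ℝ) + 1) ^ 2 * ((d : ℝ) + 4)) * ε₀) * (1 + 8 * (131072 * ((d : ℝ) + 1) ^ 2) * cB) ≤ 2 ∧
        2 * cB ≤ c3 d L ∧ 2048 * (d : ℝ) * cB ≤ 1 ∧ 40 * d * cB ≤ 1 / 200 ∧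
        200 * C6 d * (2 * α₄) ≤ 1 ∧ 12000 * ((d : ℝ) + 1) * L * (2 * α₄) ≤ 1 ∧
        C4G d L * (ε₀ + 40 * d * cB + 4 * (2 * α₄)) ≤ 1 ∧
        1024 * ((d : ℝ) + 1) * ((d : ℝ) + 4) * L ^ 2 * ε₀ ≤ 1 ∧
        32 * ((d : ℝ) + 1) ^ 2 * C6 d * L ^ 2 * ε₀ ≤ 1 ∧
        16 * d * C5' d * C6 d * (L : ℝ) ^ 2 * ε₀ ≤ 1 ∧
        2 * C6 d * (40 * d * cB + 4 * α₄) ≤ 1 / 8 ∧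
        α₄ ≤ 1 / 70 ∧ 0 ≤ cA ∧ cA ≤ 1 / 12 ∧ cA ≤ 1 / 13 ∧
        (L : ℝ) * (2 * s) ≤ cA ∧ 4 * (d : ℝ) * (L : ℝ) ^ 2 * s ≤ cDA ∧
        0 ≤ Cb ∧ 0 ≤ Cl ∧ Cb ≤ α₄ / (2 * B₀'H) ∧ Cl * B₀'H ≤ 1 / 2 ∧
        2 * s ≤ cstar ∧ 2 * s ≤ 1 ∧ 8 * 3800 * ((((d + 2) * L : ℕ) : ℝ)) ^ 2 * (2 * L * (2 * s)) ≤ 1 ∧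
        cstar ≤ Bsz * ε₀) ∧
      -- (a) the window arguments of ✓`hTorus_base_of_windows` ∕ `torusPackage_of_reads`, in its order (at `k = 1`)
      (0 ≤ s ∧ 0 < α₄ ∧ s ≤ ((L : ℝ) ^ 1)⁻¹ * σ ∧
        δ = 8 * ((((d + 2) * L : ℕ)) : ℝ) * σ ∧ ω = (d : ℝ) * L * α₄ / 2 ∧ τ₀ = 16 * m₀ * σ ∧
        8 * 3800 * ((((d + 2) * L : ℕ) : ℝ)) ^ 2 * σ ≤ 1 ∧ 32 * (m₀ : ℝ) * σ ≤ 1 ∧ d * (M' + ρ') ≤ m₀ ∧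
        160 * (α₄ + δ + 11 * ω) ≤ 1 / 4 ∧
        640 * (α₄ + δ + 5 * ω) * ω ≤ Cb ∧ 10240 * ((d : ℝ) * L) * (α₄ + δ + 11 * ω) ≤ Cl ∧
        (∀ τ : ℝ, 0 ≤ τ → τ ≤ τ₀ →
          B₀'H * τ < α₄ / 4 ∧ α₄ / 4 + B₀'H * (Cb + τ) ≤ 1 / 24 ∧ α₄ / 4 + B₀'H * (Cb + τ) ≤ 1 / 140 ∧
          10 * (α₄ / 4 + B₀'H * (Cb + τ)) * BR ≤ 1 / 2 ∧ B₀'H * (Cb + τ) ≤ 3 * α₄ / 4 ∧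
          BG * Mc d BR (α₄ / 4 + B₀'H * (Cb + τ)) cA (B₂' * (Cb + τ)) cDA ≤ α₄ / 4 ∧
          BG * Kc d BR (α₄ / 4 + B₀'H * (Cb + τ)) cA (B₂' * (Cb + τ)) cDA (B₂' * (2 * Cl)) (1 + B₀'H * (2 * Cl)) (1 + B₀'H * (2 * Cl))
            ≤ 1 / 2)) := by
  have hL2 : 2 ≤ L := le_trans (by norm_num) hL
  obtain ⟨m₀, α₀, α₁, a₆₆, cstar, B₀', α₄, C₂, cB, cA, cDA, c', σ, δ, ω, Cb, Cl, τ₀,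
    hm₀d, hα₀, ha₆₆, hα₁d, hcs, hB₀'d, hα₄d, hC₂d, hcBd, hcAd, hcDAd, hc'd, hσd, hδd, hωd, hτ₀d,
    ⟨hm₀1, hα₀0, hα₁0, hα₁0', ha₆₆α₁, ha₆₆lo, hB₀'0, hα₄0', hα₄0, hB₀0, hcs0, hCb0, hCl0, hc'0, hcA0, hσ0, hδ0, hω0, hτ₀0⟩,
    ⟨h84, h12, ha4, h2a, hC0, hc2, h16, hd5, hsmallP, hc₃P, hside, h50, hC₂, h61⟩,
    ⟨hα₀9, hcs9, h36, h61b, hdLα₁, hcB, hcA, hcDA, hsmall, hc₃, hsc, hα₃', hs₁, hs₂, hs₃, hs₄, hs₅, hs₆, hs₇, hprod8, hcA13,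
      hCbC, hCb₀, hClC, hCl₀, hCbρ, hClB⟩,
    ⟨hα70, hcA12, hbudc', hexpc', hC0', hc2', ha6, hc'σ, h2Lc, h2La, hexpσ, hbudσ, hmσ, hr⟩, hwin⟩ :=
    exists_topCall_constants_of_rhoWindow₃ d L hd hL2 hB₀ hB₀'H hB₂' hBG hBR hcB9 M' ρ' hε₀ hw
  subst hα₀
  -- letters
  have hL1 : (1 : ℝ) ≤ L := by exact_mod_cast (le_trans (by norm_num) hL : 1 ≤ L)
  have hL0 : (0 : ℝ) < L := by linarith only [hL1]
  have hM'1 : (1 : ℝ) ≤ M' := by exact_mod_cast hM'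
  have hρ'0 : (0 : ℝ) ≤ ρ' := Nat.cast_nonneg _
  have hd0 : (0 : ℝ) ≤ d := Nat.cast_nonneg _
  set s' : ℝ := ((ρ' : ℝ) + M' + 1) * α₀ with hs'def
  have hs'1 : α₀ ≤ s' := by
    have h1 : (1 : ℝ) ≤ (ρ' : ℝ) + M' + 1 := by linarith only [hρ'0, hM'1]
    calc α₀ = 1 * α₀ := (one_mul α₀).symm
      _ ≤ ((ρ' : ℝ) + M' + 1) * α₀ := mul_le_mul_of_nonneg_right h1 hα₀0.le
  have hs'0 : 0 ≤ s' := hα₀0.le.trans hs'1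
  -- `s := a₆₆` in the consumer's spelling
  have ha₆₆S : a₆₆ = (198 + 12 * (((M' : ℝ) - 1) + 4 * ρ')) * α₀ := by rw [ha₆₆]; ring
  have ha₆₆0 : 0 ≤ a₆₆ := by
    rw [ha₆₆S]
    have : (0 : ℝ) ≤ 198 + 12 * (((M' : ℝ) - 1) + 4 * ρ') := by linarith only [hρ'0, hM'1]
    exact mul_nonneg this hα₀0.le
  -- `c⋆ = 15LB₀ε₀ + 2970LB₀s′ + 405s′` (`d = 3`)
  have hd3 : (d : ℝ) = 3 := by exact_mod_cast hd
  have hLB : (L : ℝ) * B₀ ≠ 0 := mul_ne_zero hL0.ne' hB₀.ne'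
  have hcs' : cstar = 15 * (L : ℝ) * B₀ * α₀ + 2970 * (L : ℝ) * B₀ * s' + 405 * s' := by
    rw [hcs, hα₁d, hd3]
    field_simp
    ring
  have hLB0 : 0 ≤ (L : ℝ) * B₀ := by positivity
  have h405 : 405 * s' ≤ cstar := by
    have h1 := mul_nonneg hLB0 hα₀0.le
    have h2 := mul_nonneg hLB0 hs'0
    rw [hcs']; linarith only [h1, h2]
  have h4a : 4 * a₆₆ ≤ cstar := by
    refine le_trans ?_ h405
    have hcoef : 4 * (198 + 12 * (((M' : ℝ) - 1) + 4 * ρ')) ≤ 405 * ((ρ' : ℝ) + M' + 1) := by linarith only [hρ'0, hM'1]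
    calc 4 * a₆₆ = (4 * (198 + 12 * (((M' : ℝ) - 1) + 4 * ρ'))) * α₀ := by rw [ha₆₆S]; ring
      _ ≤ (405 * ((ρ' : ℝ) + M' + 1)) * α₀ := mul_le_mul_of_nonneg_right hcoef hα₀0.le
      _ = 405 * s' := by rw [hs'def]; ring
  -- the derived windows
  have hε7 : 10 ^ 7 * (L : ℝ) ^ 3 * α₀ ≤ 1 := by
    refine le_trans ?_ hw
    have hX : (1 : ℝ) ≤ (1 + B₀ + B₀⁻¹) ^ 2 := one_le_pow₀ (by linarith only [hB₀.le, (inv_pos.2 hB₀).le])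
    have hY : (1 : ℝ) ≤ ((1 + B₀'H) * (1 + B₂') * (1 + BG) * (1 + BR)) ^ 5 := by
      refine one_le_pow₀ ?_
      have h1 : (1 : ℝ) ≤ 1 + B₀'H := by linarith only [hB₀'H.le]
      have h2 : (1 : ℝ) ≤ 1 + B₂' := by linarith only [hB₂']
      have h3 : (1 : ℝ) ≤ 1 + BG := by linarith only [hBG]
      have h4 : (1 : ℝ) ≤ 1 + BR := by linarith only [hBR]
      calc (1 : ℝ) = 1 * 1 * 1 * 1 := by ring
        _ ≤ (1 + B₀'H) * (1 + B₂') * (1 + BG) * (1 + BR) := by gcongr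
    have hZ : (1 : ℝ) ≤ 1 + cB9⁻¹ := by linarith only [(inv_pos.2 hcB9).le]
    have hW : (1 : ℝ) ≤ ((ρ' : ℝ) + M' + 1) ^ 3 := one_le_pow₀ (by linarith only [hρ'0, hM'1])
    have hL3 : (L : ℝ) ^ 3 ≤ (L : ℝ) ^ 12 := pow_le_pow_right₀ hL1 (by norm_num)
    calc 10 ^ 7 * (L : ℝ) ^ 3 * α₀ = 10 ^ 7 * (L : ℝ) ^ 3 * 1 * 1 * 1 * (1 * α₀) := by ring
      _ ≤ (10 : ℝ) ^ 29 * (L : ℝ) ^ 12 * (1 + B₀ + B₀⁻¹) ^ 2 * ((1 + B₀'H) * (1 + B₂') * (1 + BG) * (1 + BR)) ^ 5 * (1 + cB9⁻¹) *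
          (((ρ' : ℝ) + M' + 1) ^ 3 * α₀) := by gcongr <;> norm_num
  have hcAw : (L : ℝ) * (2 * a₆₆) ≤ cA := by
    rw [hcAd]; exact mul_le_mul_of_nonneg_left h2a hL0.le
  have hcDAw : 4 * (d : ℝ) * (L : ℝ) ^ 2 * a₆₆ ≤ cDA := by
    rw [hcDAd]
    have : (d : ℝ) * (L : ℝ) ^ 2 * (4 * a₆₆) ≤ (d : ℝ) * (L : ℝ) ^ 2 * cstar := mul_le_mul_of_nonneg_left h4a (by positivity)
    linarith only [this]
  have hs1 : 2 * a₆₆ ≤ 1 := by linarith only [ha4]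
  have hbud : 8 * 3800 * ((((d + 2) * L : ℕ) : ℝ)) ^ 2 * (2 * L * (2 * a₆₆)) ≤ 1 := by
    refine le_trans (mul_le_mul_of_nonneg_left ?_ (by positivity)) hbudσ
    rw [hσd]
    have h1 : 2 * a₆₆ ≤ cstar + a₆₆ := by linarith only [h2a, ha₆₆0]
    exact mul_le_mul_of_nonneg_left h1 (by positivity)
  have hcsB : cstar ≤ Bsz * α₀ := by
    have h1 : cstar ≤ (2985 * (L : ℝ) * B₀ + 405) * s' := by
      have h3 : 15 * (L : ℝ) * B₀ * α₀ ≤ 15 * (L : ℝ) * B₀ * s' := mul_le_mul_of_nonneg_left hs'1 (by positivity)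
      rw [hcs']; linarith only [h3]
    have h2 : (2985 * (L : ℝ) * B₀ + 405) * s' = (2985 * (L : ℝ) * B₀ + 405) * ((ρ' : ℝ) + M' + 1) * α₀ := by rw [hs'def]; ring
    rw [h2] at h1
    exact h1.trans (mul_le_mul_of_nonneg_right hBsz hα₀0.le)
  have hsσ : a₆₆ ≤ ((L : ℝ) ^ 1)⁻¹ * σ := by
    rw [pow_one]
    have h1 : (L : ℝ) * a₆₆ ≤ σ := by
      have h2 := mul_nonneg hL0.le ha₆₆0
      linarith only [h2, h2La]
    calc a₆₆ = (L : ℝ)⁻¹ * ((L : ℝ) * a₆₆) := by field_simp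
      _ ≤ (L : ℝ)⁻¹ * σ := mul_le_mul_of_nonneg_left h1 (inv_nonneg.2 hL0.le)
  have hm₀ : d * (M' + ρ') ≤ m₀ := by rw [hm₀d, hd]; omega
  refine ⟨a₆₆, cstar, C₂, cB, cA, cDA, Cb, Cl, α₁, α₄, σ, δ, ω, τ₀, m₀,
    ⟨hε7, ha₆₆S, ha6, hα₁0, hα₄0, hcs, hC0, hc2, h16, hd5, hsmallP, hc₃P, hside, h50, hC₂, h61, hcB, hsmall, hc₃, hsc, hα₃',
      hs₁, hs₂, hs₃, hs₄, hs₅, hs₆, hprod8, hα70, hcA0, hcA12, hcA13, hcAw, hcDAw, hCb0, hCl0, hCbρ, hClB, h2a, hs1, hbud, hcsB⟩,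
    ⟨ha₆₆0, hα₄0, hsσ, hδd, hωd, hτ₀d, hbudσ, hmσ, hm₀, hr, hCb₀, hCl₀, hwin⟩⟩

/-! ## §2 (v1.1, APPEND-ONLY) The same glue for the k ≥ 2 composer ✓`HalvingHSiteRowsOfSockets.siteRows_of_sockets` (p663005) -/

set_option maxHeartbeats 400000 in
/-- ★ **THE SCALAR WINDOWS OF THE k ≥ 2 COMPOSER FROM THE ONE CUBIC SMALLNESS** — the twin of `baseArgs_of_hw` for ✓`siteRows_of_sockets (h2 : 2 ≤ K − n)`:
`hε hsdef hs6`, then its 54 displayed scalar binders IN ORDER (`hα₁ hB₀' hsα₁ hc hα₄ hs₂ hside₀ hC₂ h61₀ hsmall₁ hα3 hα4 h16 hd5 hsmallP hc₃P hside h50 h61 hcBlo hcAlo hcDAlo hsmall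
hc₃ hsc hα₃' hs₁ hs₂' hs₃ hs₄ hs₅ hs₆ hs₇ hprod8 hα70 hcA0 hcA12 hcA13 hCblo hCllo hCbρ hClB hσ hδ hω hτ₀ hbudget hm hm₀ hr hCb₀ hCl₀ hwin hcsB`), then the two post-`SB9`
thresholds `hα₀9 hcs9` — all conjuncts of ✓`exists_topCall_constants_of_rhoWindow₃` (0)–(5) by position except `hε hm₀ hcsB` (§1's arithmetic).
[cite: Balaban1985RegularSpaces, Thm 4 p.88, Prop. 3 p.87, Prop. 5 (1.106) p.94, Sect. E (1.110)-(1.125) pp.95-97; Balaban1985Averaging, (54) p.26, (203)-(214) pp.49-50; Balaban1985Variational, (150)-(168) pp.301-304] -/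
theorem stepArgs_of_hw (d L : ℕ) (hd : d = 3) (hL : 3 ≤ L)
    {B₀ B₀'H B₂' BG BR cB9 Bsz : ℝ} (hB₀ : 0 < B₀) (hB₀'H : 0 < B₀'H) (hB₂' : 0 ≤ B₂') (hBG : 0 ≤ BG) (hBR : 0 ≤ BR) (hcB9 : 0 < cB9)
    (M' ρ' : ℕ) (hM' : 1 ≤ M') {ε₀ : ℝ} (hε₀ : 0 < ε₀)
    (hw : (10 : ℝ) ^ 29 * (L : ℝ) ^ 12 * (1 + B₀ + B₀⁻¹) ^ 2 * ((1 + B₀'H) * (1 + B₂') * (1 + BG) * (1 + BR)) ^ 5 * (1 + cB9⁻¹) *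
      (((ρ' : ℝ) + M' + 1) ^ 3 * ε₀) ≤ 1)
    (hBsz : (2985 * (L : ℝ) * B₀ + 405) * ((ρ' : ℝ) + M' + 1) ≤ Bsz) :
    ∃ (s α₁ B₀' cstar α₄ C₂ σ δ ω τ₀ cB cA cDA Cb Cl : ℝ) (m₀ : ℕ),
      10 ^ 7 * (L : ℝ) ^ 3 * ε₀ ≤ 1 ∧ s = (198 + 12 * (((M' : ℝ) - 1) + 4 * ρ')) * ε₀ ∧ s ≤ 1 / 6 ∧
        0 < α₁ ∧
        0 < B₀' ∧
        s ≤ α₁ ∧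
        cstar = 5 * (d : ℝ) * L * B₀ * (ε₀ + α₁) ∧
        α₄ = 8 * B₀' * (5 * (d : ℝ) * L * B₀) * (ε₀ + α₁) ∧
        L * cstar ≤ 1 / 12 ∧
        36 * d * B₀ * cstar ≤ 1 / 2 ∧
        8 * (131072 * ((d : ℝ) + 1) ^ 2) * Real.exp (4 * (800 * ((d : ℝ) + 1) ^ 2 * ((d : ℝ) + 4)) * ε₀) ≤ C₂ ∧
        2 * cstar ^ 2 + 20 * d * ε₀ * cstar + 2 * C₂ * cstar ^ 2 ≤ ε₀ + α₁ ∧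
        (d : ℝ) * L * α₁ ≤ 1 / 8 ∧
        C0 d * ε₀ ≤ 1 / 3 ∧
        4 * ε₀ ≤ c2' d L ∧
        16 * (2 * (L * cstar) + 8 * α₄) ≤ 1 ∧
        5 * (2 * (L * cstar) + 8 * α₄) * ((d : ℝ) - 1) ≤ 4 ∧
        Real.exp (4 * (800 * ((d : ℝ) + 1) ^ 2 * ((d : ℝ) + 4)) * ε₀) * (1 + 8 * (131072 * ((d : ℝ) + 1) ^ 2) * (2 * (L * cstar) + 8 * α₄)) ≤ 2 ∧
        2 * (2 * (L * cstar) + 8 * α₄) ≤ c3 d L ∧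
        36 * d * B₀ * (2 * (L * cstar) + 8 * α₄) ≤ 1 / 2 ∧
        50 * d * (2 * (L * cstar) + 8 * α₄) ≤ 1 ∧
        2 * (2 * (L * cstar) + 8 * α₄) ^ 2 + 20 * d * ε₀ * (2 * (L * cstar) + 8 * α₄) + 2 * C₂ * (2 * (L * cstar) + 8 * α₄) ^ 2 ≤ ε₀ + α₁ ∧
        L * cstar ≤ cB ∧
        L * cstar ≤ cA ∧
        (d : ℝ) * (L : ℝ) ^ 2 * cstar ≤ cDA ∧
        Real.exp (4 * (800 * ((d : ℝ) + 1) ^ 2 * ((d : ℝ) + 4)) * ε₀) * (1 + 8 * (131072 * ((d : ℝ) + 1) ^ 2) * cB) ≤ 2 ∧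
        2 * cB ≤ c3 d L ∧
        2048 * (d : ℝ) * cB ≤ 1 ∧
        40 * d * cB ≤ 1 / 200 ∧
        200 * C6 d * (2 * α₄) ≤ 1 ∧
        12000 * ((d : ℝ) + 1) * L * (2 * α₄) ≤ 1 ∧
        C4G d L * (ε₀ + 40 * d * cB + 4 * (2 * α₄)) ≤ 1 ∧
        1024 * ((d : ℝ) + 1) * ((d : ℝ) + 4) * L ^ 2 * ε₀ ≤ 1 ∧
        32 * ((d : ℝ) + 1) ^ 2 * C6 d * L ^ 2 * ε₀ ≤ 1 ∧
        16 * d * C5' d * C6 d * (L : ℝ) ^ 2 * ε₀ ≤ 1 ∧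
        8 * d * C6 d * L * ε₀ ≤ 1 ∧
        2 * C6 d * (40 * d * cB + 4 * α₄) ≤ 1 / 8 ∧
        α₄ ≤ 1 / 70 ∧
        0 ≤ cA ∧
        cA ≤ 1 / 12 ∧
        cA ≤ 1 / 13 ∧
        C2p d * (40 * d * cB + α₄) * α₄ ≤ Cb ∧
        2 * C2p d * (40 * d * cB + 2 * α₄) ≤ Cl ∧
        Cb ≤ α₄ / (2 * B₀'H) ∧
        Cl * B₀'H ≤ 1 / 2 ∧
        2 * L * cstar ≤ σ ∧
        δ = 8 * (((d + 2) * L : ℕ) : ℝ) * σ ∧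
        ω = (d : ℝ) * L * α₄ / 2 ∧
        τ₀ = 16 * m₀ * σ ∧
        8 * 3800 * (((d + 2) * L : ℕ) : ℝ) ^ 2 * σ ≤ 1 ∧
        32 * (m₀ : ℝ) * σ ≤ 1 ∧
        d * (M' + ρ') ≤ m₀ ∧
        160 * (α₄ + δ + 11 * ω) ≤ 1 / 4 ∧
        640 * (α₄ + δ + 5 * ω) * ω ≤ Cb ∧
        10240 * ((d : ℝ) * L) * (α₄ + δ + 11 * ω) ≤ Cl ∧
        (∀ τ : ℝ, 0 ≤ τ → τ ≤ τ₀ → B₀'H * τ < α₄ / 4 ∧ α₄ / 4 + B₀'H * (Cb + τ) ≤ 1 / 24 ∧ α₄ / 4 + B₀'H * (Cb + τ) ≤ 1 / 140 ∧ 10 * (α₄ / 4 + B₀'H * (Cb + τ)) * BR ≤ 1 / 2 ∧ B₀'H * (Cb + τ) ≤ 3 * α₄ / 4 ∧ BG * Mc d BR (α₄ / 4 + B₀'H * (Cb + τ)) cA (B₂' * (Cb + τ)) cDA ≤ α₄ / 4 ∧ BG * Kc d BR (α₄ / 4 + B₀'H * (Cb + τ)) cA (B₂' * (Cb + τ)) cDA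 (B₂' * (2 * Cl)) (1 + B₀'H * (2 * Cl)) (1 + B₀'H * (2 * Cl)) ≤ 1 / 2) ∧
        cstar ≤ Bsz * ε₀ ∧
        ε₀ ≤ cB9 ∧ cstar ≤ cB9 := by
  have hL2 : 2 ≤ L := le_trans (by norm_num) hL
  obtain ⟨m₀, α₀, α₁, a₆₆, cstar, B₀', α₄, C₂, cB, cA, cDA, c', σ, δ, ω, Cb, Cl, τ₀,
    hm₀d, hα₀, ha₆₆, hα₁d, hcs, hB₀'d, hα₄d, hC₂d, hcBd, hcAd, hcDAd, hc'd, hσd, hδd, hωd, hτ₀d,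
    ⟨hm₀1, hα₀0, hα₁0, hα₁0', ha₆₆α₁, ha₆₆lo, hB₀'0, hα₄0', hα₄0, hB₀0, hcs0, hCb0, hCl0, hc'0, hcA0, hσ0, hδ0, hω0, hτ₀0⟩,
    ⟨h84, h12, ha4, h2a, hC0, hc2, h16, hd5, hsmallP, hc₃P, hside, h50, hC₂, h61⟩,
    ⟨hα₀9, hcs9, h36, h61b, hdLα₁, hcB, hcA, hcDA, hsmall, hc₃, hsc, hα₃', hs₁, hs₂, hs₃, hs₄, hs₅, hs₆, hs₇, hprod8, hcA13,
      hCbC, hCb₀, hClC, hCl₀, hCbρ, hClB⟩,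
    ⟨hα70, hcA12, hbudc', hexpc', hC0', hc2', ha6, hc'σ, h2Lc, h2La, hexpσ, hbudσ, hmσ, hr⟩, hwin⟩ :=
    exists_topCall_constants_of_rhoWindow₃ d L hd hL2 hB₀ hB₀'H hB₂' hBG hBR hcB9 M' ρ' hε₀ hw
  subst hα₀
  -- letters
  have hL1 : (1 : ℝ) ≤ L := by exact_mod_cast (le_trans (by norm_num) hL : 1 ≤ L)
  have hL0 : (0 : ℝ) < L := by linarith only [hL1]
  have hM'1 : (1 : ℝ) ≤ M' := by exact_mod_cast hM'
  have hρ'0 : (0 : ℝ) ≤ ρ' := Nat.cast_nonneg _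
  have hd0 : (0 : ℝ) ≤ d := Nat.cast_nonneg _
  set s' : ℝ := ((ρ' : ℝ) + M' + 1) * α₀ with hs'def
  have hs'1 : α₀ ≤ s' := by
    have h1 : (1 : ℝ) ≤ (ρ' : ℝ) + M' + 1 := by linarith only [hρ'0, hM'1]
    calc α₀ = 1 * α₀ := (one_mul α₀).symm
      _ ≤ ((ρ' : ℝ) + M' + 1) * α₀ := mul_le_mul_of_nonneg_right h1 hα₀0.le
  have hs'0 : 0 ≤ s' := hα₀0.le.trans hs'1
  -- `s := a₆₆` in the consumer's spelling
  have ha₆₆S : a₆₆ = (198 + 12 * (((M' : ℝ) - 1) + 4 * ρ')) * α₀ := by rw [ha₆₆]; ring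
  have ha₆₆0 : 0 ≤ a₆₆ := by
    rw [ha₆₆S]
    have : (0 : ℝ) ≤ 198 + 12 * (((M' : ℝ) - 1) + 4 * ρ') := by linarith only [hρ'0, hM'1]
    exact mul_nonneg this hα₀0.le
  -- `c⋆ = 15LB₀ε₀ + 2970LB₀s′ + 405s′` (`d = 3`)
  have hd3 : (d : ℝ) = 3 := by exact_mod_cast hd
  have hLB : (L : ℝ) * B₀ ≠ 0 := mul_ne_zero hL0.ne' hB₀.ne'
  have hcs' : cstar = 15 * (L : ℝ) * B₀ * α₀ + 2970 * (L : ℝ) * B₀ * s' + 405 * s' := by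
    rw [hcs, hα₁d, hd3]
    field_simp
    ring
  have hLB0 : 0 ≤ (L : ℝ) * B₀ := by positivity
  have h405 : 405 * s' ≤ cstar := by
    have h1 := mul_nonneg hLB0 hα₀0.le
    have h2 := mul_nonneg hLB0 hs'0
    rw [hcs']; linarith only [h1, h2]
  have h4a : 4 * a₆₆ ≤ cstar := by
    refine le_trans ?_ h405
    have hcoef : 4 * (198 + 12 * (((M' : ℝ) - 1) + 4 * ρ')) ≤ 405 * ((ρ' : ℝ) + M' + 1) := by linarith only [hρ'0, hM'1]
    calc 4 * a₆₆ = (4 * (198 + 12 * (((M' : ℝ) - 1) + 4 * ρ'))) * α₀ := by rw [ha₆₆S]; ring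
      _ ≤ (405 * ((ρ' : ℝ) + M' + 1)) * α₀ := mul_le_mul_of_nonneg_right hcoef hα₀0.le
      _ = 405 * s' := by rw [hs'def]; ring
  -- the derived windows
  have hε7 : 10 ^ 7 * (L : ℝ) ^ 3 * α₀ ≤ 1 := by
    refine le_trans ?_ hw
    have hX : (1 : ℝ) ≤ (1 + B₀ + B₀⁻¹) ^ 2 := one_le_pow₀ (by linarith only [hB₀.le, (inv_pos.2 hB₀).le])
    have hY : (1 : ℝ) ≤ ((1 + B₀'H) * (1 + B₂') * (1 + BG) * (1 + BR)) ^ 5 := by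
      refine one_le_pow₀ ?_
      have h1 : (1 : ℝ) ≤ 1 + B₀'H := by linarith only [hB₀'H.le]
      have h2 : (1 : ℝ) ≤ 1 + B₂' := by linarith only [hB₂']
      have h3 : (1 : ℝ) ≤ 1 + BG := by linarith only [hBG]
      have h4 : (1 : ℝ) ≤ 1 + BR := by linarith only [hBR]
      calc (1 : ℝ) = 1 * 1 * 1 * 1 := by ring
        _ ≤ (1 + B₀'H) * (1 + B₂') * (1 + BG) * (1 + BR) := by gcongr
    have hZ : (1 : ℝ) ≤ 1 + cB9⁻¹ := by linarith only [(inv_pos.2 hcB9).le]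
    have hW : (1 : ℝ) ≤ ((ρ' : ℝ) + M' + 1) ^ 3 := one_le_pow₀ (by linarith only [hρ'0, hM'1])
    have hL3 : (L : ℝ) ^ 3 ≤ (L : ℝ) ^ 12 := pow_le_pow_right₀ hL1 (by norm_num)
    calc 10 ^ 7 * (L : ℝ) ^ 3 * α₀ = 10 ^ 7 * (L : ℝ) ^ 3 * 1 * 1 * 1 * (1 * α₀) := by ring
      _ ≤ (10 : ℝ) ^ 29 * (L : ℝ) ^ 12 * (1 + B₀ + B₀⁻¹) ^ 2 * ((1 + B₀'H) * (1 + B₂') * (1 + BG) * (1 + BR)) ^ 5 * (1 + cB9⁻¹) *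
          (((ρ' : ℝ) + M' + 1) ^ 3 * α₀) := by gcongr <;> norm_num
  have hcAw : (L : ℝ) * (2 * a₆₆) ≤ cA := by
    rw [hcAd]; exact mul_le_mul_of_nonneg_left h2a hL0.le
  have hcDAw : 4 * (d : ℝ) * (L : ℝ) ^ 2 * a₆₆ ≤ cDA := by
    rw [hcDAd]
    have : (d : ℝ) * (L : ℝ) ^ 2 * (4 * a₆₆) ≤ (d : ℝ) * (L : ℝ) ^ 2 * cstar := mul_le_mul_of_nonneg_left h4a (by positivity)
    linarith only [this]
  have hs1 : 2 * a₆₆ ≤ 1 := by linarith only [ha4]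
  have hbud : 8 * 3800 * ((((d + 2) * L : ℕ) : ℝ)) ^ 2 * (2 * L * (2 * a₆₆)) ≤ 1 := by
    refine le_trans (mul_le_mul_of_nonneg_left ?_ (by positivity)) hbudσ
    rw [hσd]
    have h1 : 2 * a₆₆ ≤ cstar + a₆₆ := by linarith only [h2a, ha₆₆0]
    exact mul_le_mul_of_nonneg_left h1 (by positivity)
  have hcsB : cstar ≤ Bsz * α₀ := by
    have h1 : cstar ≤ (2985 * (L : ℝ) * B₀ + 405) * s' := by
      have h3 : 15 * (L : ℝ) * B₀ * α₀ ≤ 15 * (L : ℝ) * B₀ * s' := mul_le_mul_of_nonneg_left hs'1 (by positivity)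
      rw [hcs']; linarith only [h3]
    have h2 : (2985 * (L : ℝ) * B₀ + 405) * s' = (2985 * (L : ℝ) * B₀ + 405) * ((ρ' : ℝ) + M' + 1) * α₀ := by rw [hs'def]; ring
    rw [h2] at h1
    exact h1.trans (mul_le_mul_of_nonneg_right hBsz hα₀0.le)
  have hsσ : a₆₆ ≤ ((L : ℝ) ^ 1)⁻¹ * σ := by
    rw [pow_one]
    have h1 : (L : ℝ) * a₆₆ ≤ σ := by
      have h2 := mul_nonneg hL0.le ha₆₆0
      linarith only [h2, h2La]
    calc a₆₆ = (L : ℝ)⁻¹ * ((L : ℝ) * a₆₆) := by field_simp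
      _ ≤ (L : ℝ)⁻¹ * σ := mul_le_mul_of_nonneg_left h1 (inv_nonneg.2 hL0.le)
  have hm₀ : d * (M' + ρ') ≤ m₀ := by rw [hm₀d, hd]; omega
  exact ⟨a₆₆, α₁, B₀', cstar, α₄, C₂, σ, δ, ω, τ₀, cB, cA, cDA, Cb, Cl, m₀,
    hε7, ha₆₆S, ha6, hα₁0, hB₀'0, ha₆₆α₁, hcs, hα₄d, h12, h36, hC₂, h61b, hdLα₁, hC0, hc2, h16, hd5, hsmallP, hc₃P, hside, h50, h61,
    hcB, hcA, hcDA, hsmall, hc₃, hsc, hα₃', hs₁, hs₂, hs₃, hs₄, hs₅, hs₆, hs₇, hprod8, hα70, hcA0, hcA12, hcA13, hCbC, hClC, hCbρ, hClB,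
    h2Lc, hδd, hωd, hτ₀d, hbudσ, hmσ, hm₀, hr, hCb₀, hCl₀, hwin, hcsB, hα₀9, hcs9⟩

end Summit.QuantumFields.YangMills.Theorems.HalvingHSiteBaseArgsOfRhoWindow

end
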